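import Literature.NumberTheory.Sieve.PolymathThetaSumsProofs
import Literature.NumberTheory.Sieve.ParityWave0Proofs
import Literature.NumberTheory.Sieve.VaughanMeanValue
import Literature.NumberTheory.LFunctions.SiegelWalfisz
import HarnessLib

/-!
# Polymath 8b, Theorem 1.4(i) (`H₁ ≤ 246`) reduced to one numerical certificate at `k = 50`

Trunk: AntSieve / parity.S13.  Assembly file for the named fact
`Literature.NumberTheory.Sieve.frequently_nth_prime_succ_le_add_polymath` (`liminf (p_{n+1} − p_n) ≤ 246`;
D. H. J. Polymath, *Variants of the Selberg sieve, and bounded intervals containing many primes*,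
Res. Math. Sci. 1:12 (2014) = arXiv:1407.4897, Theorem 1.4(i)).  With the Bombieri–Vinogradov theorem
proved in the tree (`bombieri_vinogradov_of_siegelWalfisz`, `LFunctions.siegel_walfisz_holds`, bridged by
`bombieriVinogradovStatement_of_bombieri_vinogradov`), Theorem 3.12(i) proved
(`weakDHL_of_polymathFunctional_gt_holds`, `PolymathThetaSumsProofs.lean`) and the admissible 50-tuple of
diameter 246 (`PolymathBoundedGaps.lean`), the printed deduction of Theorem 1.4(i) (p. 11: "`DHL[50,2]`
follows from Theorem 3.12(i), Bombieri–Vinogradov and `M_{50,1/25} > 4.0043`") needs only *some* test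
function at `k = 50` with `(∑ᵢ J_{i,1−ε}(F))/I(F) > 4` for *some* `0 < ε < 1`: then one may take `ϑ` with
`2/M < ϑ < 1/2` (so that `2·1/ϑ < M`, `1 + ε < 2 < 1/ϑ`).  This file PROVES that reduction,
`frequently_nth_prime_succ_le_add_polymath_of_exists_gt_four`, so that the discharge of the Wave-0 fact
rests on exactly one computational statement (Theorem 3.13(i), `exists_polymathFunctional_fifty_gt`,
is the printed instance `ε = 1/25`, value `4.0043`; `frequently_nth_prime_succ_le_add_polymath_of_fifty`
records that it suffices).

## References

* D. H. J. Polymath, *Variants of the Selberg sieve, and bounded intervals containing many primes*,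
  Res. Math. Sci. 1 (2014), Art. 12; arXiv:1407.4897, Theorem 1.4(i), Theorem 3.2(i) (p. 11),
  Theorems 3.12(i), 3.13(i). [Polymath8b2014]
-/

noncomputable section

open MeasureTheory Filter Finset

namespace Literature.NumberTheory.Sieve

/-- **`H₁ ≤ 246` from any `k = 50` certificate exceeding `4`** (Polymath 8b, deduction of Theorem 1.4(i)
from Theorems 3.12(i), 2.3 (Bombieri–Vinogradov) and 3.3(i), pp. 8 and 11): if some test function `F` on
`(1+ε)·R_50`, `0 < ε < 1`, has `(∑ᵢ J_{i,1−ε}(F))/I(F) > 4`, then `p_{n+1} ≤ p_n + 246` infinitely often.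
All ingredients are theorems of the tree. [cite: Polymath8b2014, Theorem 1.4(i) (deduction, pp. 8 and 11)] -/
theorem frequently_nth_prime_succ_le_add_polymath_of_exists_gt_four
    (h : ∃ (ε : ℝ) (F : (Fin 50 → ℝ) → ℝ), 0 < ε ∧ ε < 1 ∧ IsPolymathTestFunction 50 ε F ∧
      4 < polymathFunctional 50 ε F) :
    frequently_nth_prime_succ_le_add_polymath := by
  obtain ⟨ε, F, hε0, hε1, hF, hM⟩ := h
  set M : ℝ := polymathFunctional 50 ε F with hMdef
  -- the level `ϑ` with `2/M < ϑ < 1/2`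
  set θ : ℝ := (2 / M + 1 / 2) / 2 with hθdef
  have hM0 : 0 < M := lt_trans (by norm_num) hM
  have h2M : 2 / M < 1 / 2 := by rw [div_lt_div_iff₀ hM0 (by norm_num)]; linarith
  have h2M0 : 0 < 2 / M := by positivity
  have hθlo : 2 / M < θ := by rw [hθdef]; linarith
  have hθhi : θ < 1 / 2 := by rw [hθdef]; linarith
  have hθ0 : 0 < θ := lt_trans h2M0 hθlo
  have hθ1 : θ < 1 := by linarith
  -- Bombieri–Vinogradov
  have hBV : BombieriVinogradovStatement :=
    bombieriVinogradovStatement_of_bombieri_vinogradov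
      (bombieri_vinogradov_of_siegelWalfisz LFunctions.siegel_walfisz_holds)
  have hlevel : PrimesHaveLevel θ := hBV θ hθhi
  -- `1 + ε < 1/θ` and `2·1/θ < M`
  have h1ε : 1 + ε < 1 / θ := by
    rw [lt_div_iff₀ hθ0]; nlinarith
  have hMθ : 2 * ((1 : ℕ) : ℝ) / θ < polymathFunctional 50 ε F := by
    rw [Nat.cast_one, mul_one, div_lt_iff₀ hθ0, ← hMdef]
    have : 2 / M * M = 2 := by field_simp
    nlinarith
  have hDHL : WeakDicksonHardyLittlewood 50 (1 + 1) :=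
    weakDHL_of_polymathFunctional_gt_holds 50 1 (by norm_num) le_rfl ε hε0 hε1 θ hθ0 hθ1 hlevel h1ε F hF hMθ
  exact frequently_nth_prime_succ_le_add_polymath_of_weakDHL hDHL

/-- In particular Theorem 3.13(i) as vendored (`exists_polymathFunctional_fifty_gt`: `ε = 1/25`, value
`> 4.0043`) suffices, by the same route as `frequently_nth_prime_succ_le_add_polymath_of_bombieriVinogradovStatement`
with all non-numerical inputs now proved. [cite: Polymath8b2014, Theorem 1.4(i)] -/
theorem frequently_nth_prime_succ_le_add_polymath_of_fifty (h313 : exists_polymathFunctional_fifty_gt) :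
    frequently_nth_prime_succ_le_add_polymath := by
  obtain ⟨F, hF, hM⟩ := h313
  exact frequently_nth_prime_succ_le_add_polymath_of_exists_gt_four
    ⟨1 / 25, F, by norm_num, by norm_num, hF, lt_trans (by norm_num) hM⟩

end Literature.NumberTheory.Sieve
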